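import Summits.BirchSwinnertonDyer.Rank1Residual.X4.AdditiveOldShape
import Literature.NumberTheory.EllipticCurves.ModularSymbolsParabolicCohomology
import Literature.NumberTheory.EllipticCurves.NewformsStrongMultiplicityOne
import HarnessLib

/-!
# `α_* : H₁(X₀(Mℓ), ℤ) → H₁(X₀(M), ℤ)` is ONTO for `ℓ ∣ M` (total ramification at the cusp `0`), and the additive old shape without any Ihara input (cell `b2b-bsdres`, seat additive-p4, line V48/V49)

HONEST FRAMING (verbatim, cell `b2b-bsdres`): the goal of the cell is to DELETE the COMBINATION-SHAPED
residual classes for ALL analytic-rank `≤ 1` curves over `ℚ` — "full BSD formula for every rank `≤ 1`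
curve in class `C`" assembled STRICTLY from published theorems — so that the rank-`≤ 1` remainder
becomes exactly the CONSTRUCTION-SHAPED classes, which are TYPED (missing-input Props), NOT attempted;
this is not "finishing BSD". This file: TOOL theorems (modular symbols), 0 defs, 0 facts, nothing
booked; X4 CONSTRUCTION-SHAPED.

## What is proved

* `exists_dualMap_degeneracyMap0_one_eq_of_dvd`: for a prime `ℓ ∣ M`, EVERY cycle of level `M` is
  the push-forward `α_* z` of a cycle `z` of level `Mℓ` — the ONE-copy map `α_*` is surjective on
  integral homology, unconditionally (no localisation). Proof (Manin): `H₁(X₀(M), ℤ)` is the set of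
  period functionals `{∞, δ∞}`, `δ ∈ Γ₀(M)` (`coe_periodHomology_eq_range`); for `δ = (a b; c d)`
  put `j = a·(c/M)` and `P = (1 0; −jM 1)`: then `δP ∈ Γ₀(Mℓ)` (its lower-left entry is
  `c(1 − ad) = −b c²`, divisible by `M² ⊆ Mℓℤ` as `ℓ ∣ M`), `{∞, P⁻¹∞} = 0` (`P⁻¹` is parabolic:
  `cuspSymbol_eq_zero_of_discr_eq_zero`), so `{∞, δ∞}_M = {∞, (δP)∞}_M = α_*{∞, (δP)∞}_{Mℓ}`
  (`periodFunctional_mul`; `α` is the identity on functions, `coe_degeneracyMap0_one`).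
  Geometrically: `X₀(Mℓ) → X₀(M)` is totally ramified at the cusp `0`, so `π₁` surjects.
* `additiveOldShape_of_dvd`: the additive old shape of `X4/AdditiveOldShape` WITHOUT the two-copy
  surjectivity and WITHOUT eigen-hypotheses: if `Φ = Λ₁∘α_* + Λ₂∘β_*` on `H₁(X₀(Mℓ), ℤ)` with `Λ₂`
  additive, `Φ ∘ U_ℓ^∨ = 0` there and `ℓ ≠ 0` in `k`, then `Λ₂ = −ℓ⁻¹ Λ₁∘U_ℓ^{(M)∨}` on
  `H₁(X₀(M), ℤ)` (evaluate at a lift `z` of `x` under `α_*`: `β_* U_ℓ^∨ z = ℓ α_* z` does not involve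
  `β_* z`). So in the NL chain the hypothesis (IS) is used only for (NV) ⟹ (OLD) and for the Fitting
  projection, not for the shape.

## References

* Ju. I. Manin, *Parabolic points and zeta functions of modular curves*, Izv. 36 (1972), Prop. 1.4,
  Thm. 1.9. [cite: Manin1972, Prop. 1.4  Thm. 1.6]
* J. E. Cremona, *Algorithms for modular elliptic curves* (1997), §2.1–§2.2, §2.4. [cite: CremonaAlgorithms1997, §2.4 (2.4.1)–(2.4.2)]
* A. W. Knapp, *Elliptic Curves* (1993), Prop. 11.1 (periods over parabolic elements vanish). [cite: Knapp1993, Prop. 11.1]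
-/

noncomputable section

open scoped MatrixGroups ModularForm

open CongruenceSubgroup Matrix

open Literature.NumberTheory.EllipticCurves Literature.NumberTheory.EllipticCurves.ModularForms

namespace Summit.BirchSwinnertonDyer.Rank1Residual.LevelLowering

/-! ### §1 One-copy surjectivity of `α_*` for `ℓ ∣ M` -/

section Surjective

variable {M : ℕ} [NeZero M] {ℓ : ℕ} [Fact ℓ.Prime]

/-- The period of a level-`M` form over an element of `Γ₀(Mℓ)` is the period of its image under
`α = [1]` (the identity on functions): `α_*{∞, γ∞}_{Mℓ} = {∞, γ∞}_M`. [cite: CremonaAlgorithms1997, §2.4 (2.4.1)–(2.4.2)] -/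
theorem dualMap_degeneracyMap0_one_periodFunctional (γ : Gamma0 (M * ℓ)) (hγM : (γ : SL(2, ℤ)) ∈ Gamma0 M) :
    (degeneracyMap0 M (M * ℓ) 1 2).dualMap (periodFunctional (M * ℓ) γ) =
      periodFunctional M ⟨γ, hγM⟩ := by
  ext f
  simp only [LinearMap.dualMap_apply, periodFunctional_apply, cuspSymbol]
  by_cases hc : ((γ : SL(2, ℤ)) 1 0) = 0
  · rw [if_pos hc, if_pos hc]
  · rw [if_neg hc, if_neg hc]
    simp only [modularSymbol, coe_degeneracyMap0_one M (M * ℓ) 2 (dvd_mul_right M ℓ)]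

/-- **`α_*` IS ONTO `H₁(X₀(M), ℤ)` for `ℓ ∣ M`.** For a prime `ℓ` dividing `M`, every cycle
`w ∈ H₁(X₀(M), ℤ) = periodHomology M` is `α_* z` for a cycle `z ∈ H₁(X₀(Mℓ), ℤ)`: writing
`w = {∞, δ∞}` (Manin), `δ = (a b; c d) ∈ Γ₀(M)`, the element `δP` with `P = (1 0; −acM²/M… )` —
precisely `P = (1 0; −jM 1)`, `j = a c / M` — lies in `Γ₀(Mℓ)` (lower-left entry `−b c² ∈ M²ℤ`)
and `{∞, δ∞} = {∞, δP∞}` because `{∞, P⁻¹∞} = 0` (parabolic). Geometrically: the degeneracy map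
`X₀(Mℓ) → X₀(M)` is totally ramified over the cusp `0`. [cite: Manin1972, Prop. 1.4  Thm. 1.6]
[cite: Knapp1993, Prop. 11.1] -/
theorem exists_dualMap_degeneracyMap0_one_eq_of_dvd (hℓM : ℓ ∣ M)
    {w : Module.Dual ℂ (CuspForm (Gamma0 M) 2)} (hw : w ∈ periodHomology M) :
    ∃ z ∈ periodHomology (M * ℓ), (degeneracyMap0 M (M * ℓ) 1 2).dualMap z = w := by
  have hw' : w ∈ (periodHomology M : Set (Module.Dual ℂ (CuspForm (Gamma0 M) 2))) := hw
  rw [coe_periodHomology_eq_range] at hw'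
  obtain ⟨δ, rfl⟩ := hw'
  -- entries of `δ`
  set a : ℤ := (δ : SL(2, ℤ)) 0 0 with ha
  set b : ℤ := (δ : SL(2, ℤ)) 0 1 with hb
  set c : ℤ := (δ : SL(2, ℤ)) 1 0 with hc
  set d : ℤ := (δ : SL(2, ℤ)) 1 1 with hd
  have hdet : a * d - b * c = 1 := by
    have := Matrix.det_fin_two (δ : SL(2, ℤ)).1
    rw [(δ : SL(2, ℤ)).2] at this
    rw [ha, hb, hc, hd]; linarith
  have hMc : (M : ℤ) ∣ c := by
    have hδ := δ.2
    rw [Gamma0_mem] at hδ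
    exact (ZMod.intCast_zmod_eq_zero_iff_dvd c M).mp hδ
  obtain ⟨c₀, hc₀⟩ := hMc
  -- the parabolic correction `P = (1 0; -jM 1)`, `j = a c₀`, and its inverse `Q = (1 0; jM 1)`
  set j : ℤ := a * c₀ with hj
  let Pm : SL(2, ℤ) := ⟨!![1, 0; -(j * M), 1], by rw [Matrix.det_fin_two_of]; ring⟩
  let Qm : SL(2, ℤ) := ⟨!![1, 0; j * M, 1], by rw [Matrix.det_fin_two_of]; ring⟩
  have hPQ : Pm * Qm = 1 := by
    ext i k
    fin_cases i <;> fin_cases k <;>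
      simp [Pm, Qm, Matrix.mul_apply, Fin.sum_univ_two]
  have hPmem : Pm ∈ Gamma0 M := by
    rw [Gamma0_mem]
    change (((-(j * (M : ℤ))) : ℤ) : ZMod M) = 0
    rw [Int.cast_neg, Int.cast_mul, Int.cast_natCast, ZMod.natCast_self, mul_zero, neg_zero]
  have hQmem : Qm ∈ Gamma0 M := by
    rw [Gamma0_mem]
    change (((j * (M : ℤ)) : ℤ) : ZMod M) = 0
    rw [Int.cast_mul, Int.cast_natCast, ZMod.natCast_self, mul_zero]
  -- `δ P ∈ Γ₀(Mℓ)`: its lower-left entry is `c - d j M = c₀ M (1 - a d) = -b c₀² M²`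
  have hγmem : ((δ : SL(2, ℤ)) * Pm) ∈ Gamma0 (M * ℓ) := by
    rw [Gamma0_mem]
    have e : (((δ : SL(2, ℤ)) * Pm : SL(2, ℤ)) 1 0) = c + d * (-(j * M)) := by
      simp [Pm, Matrix.mul_apply, Fin.sum_univ_two, hc, hd]
    rw [e]
    have hdiv : ((M * ℓ : ℕ) : ℤ) ∣ c + d * (-(j * M)) := by
      obtain ⟨m, hm⟩ : (ℓ : ℤ) ∣ (M : ℤ) := Int.natCast_dvd_natCast.mpr hℓM
      refine ⟨-(b * c₀ ^ 2 * m), ?_⟩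
      have e1 : c + d * (-(j * M)) = c₀ * M * (1 - a * d) := by rw [hj, hc₀]; ring
      have e2 : (1 : ℤ) - a * d = -(b * c) := by linarith
      rw [e1, e2, hc₀]
      push_cast
      rw [show (M : ℤ) * c₀ = c₀ * M by ring]
      have : (M : ℤ) = ℓ * m := hm
      calc c₀ * (M : ℤ) * -(b * (c₀ * M)) = -(b * c₀ ^ 2 * M) * M := by ring
        _ = -(b * c₀ ^ 2 * M) * (ℓ * m) := by rw [this]
        _ = (M : ℤ) * ℓ * -(b * c₀ ^ 2 * m) := by ring
    exact (ZMod.intCast_zmod_eq_zero_iff_dvd _ (M * ℓ)).mpr hdiv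
  set γ : Gamma0 (M * ℓ) := ⟨(δ : SL(2, ℤ)) * Pm, hγmem⟩ with hγ
  have hγM : (γ : SL(2, ℤ)) ∈ Gamma0 M := Subgroup.mul_mem _ δ.2 hPmem
  -- `δ = (δP) Q` in `Γ₀(M)` and `{∞, Q∞} = 0`
  have hδeq : δ = ⟨(γ : SL(2, ℤ)), hγM⟩ * ⟨Qm, hQmem⟩ := by
    apply Subtype.ext
    change (δ : SL(2, ℤ)) = (δ : SL(2, ℤ)) * Pm * Qm
    rw [mul_assoc, hPQ, mul_one]
  have hQ0 : periodFunctional M ⟨Qm, hQmem⟩ = 0 := by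
    ext h
    rw [periodFunctional_apply, LinearMap.zero_apply]
    refine cuspSymbol_eq_zero_of_discr_eq_zero h ?_
    change (Qm : Matrix (Fin 2) (Fin 2) ℤ).discr = 0
    rw [Matrix.discr_fin_two, Matrix.trace_fin_two, Matrix.SpecialLinearGroup.det_coe]
    simp [Qm]
  refine ⟨periodFunctional (M * ℓ) γ, periodFunctional_mem_periodHomology (M * ℓ) γ, ?_⟩
  rw [dualMap_degeneracyMap0_one_periodFunctional γ hγM, hδeq, periodFunctional_mul, hQ0, add_zero]

end Surjective

/-! ### §2 The additive old shape with no Ihara input -/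

section Shape

variable {k : Type*} [Field k] {M : ℕ} [NeZero M] {ℓ : ℕ} [Fact ℓ.Prime]

/-- **THE `ℓ`-OLD SHAPE AT AN ADDITIVE PRIME, unconditionally in the pair.** `ℓ ∣ M` prime, `Φ` on
`S₂(Γ₀(Mℓ))^∨`, `Λ₁, Λ₂` on `S₂(Γ₀(M))^∨` with `Λ₂` additive on `H₁(X₀(M), ℤ)`,
`Φ = Λ₁∘α_* + Λ₂∘β_*` on `H₁(X₀(Mℓ), ℤ)`, `Φ ∘ U_ℓ^∨ = 0` there (`a_ℓ = 0`), `ℓ ≠ 0` in `k`. Then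
`Λ₂(x) = −ℓ⁻¹ Λ₁(U_ℓ^∨ x)` for every cycle `x`: lift `x = α_* z`
(`exists_dualMap_degeneracyMap0_one_eq_of_dvd`); `0 = Φ(U_ℓ^∨ z) = Λ₁(U_ℓ^∨ x) + Λ₂(ℓ x)`
(`α_* U_ℓ^∨ = U_ℓ^∨ α_*` for `ℓ ∣ M`, `β_* U_ℓ^∨ = ℓ α_*`). No eigen-hypothesis, no Ihara.
[cite: DiamondShurman2005, Prop. 5.6.2] [cite: Manin1972, Prop. 1.4  Thm. 1.6] -/
theorem additiveOldShape_of_dvd (hℓM : ℓ ∣ M)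
    (Φ : Module.Dual ℂ (CuspForm (Gamma0 (M * ℓ)) 2) → k)
    (Λ₁ Λ₂ : Module.Dual ℂ (CuspForm (Gamma0 M) 2) → k)
    (h0₂ : Λ₂ 0 = 0)
    (hadd₂ : ∀ x ∈ periodHomology M, ∀ y ∈ periodHomology M, Λ₂ (x + y) = Λ₂ x + Λ₂ y)
    (hΦ : ∀ z ∈ periodHomology (M * ℓ),
      Φ z = Λ₁ ((degeneracyMap0 M (M * ℓ) 1 2).dualMap z) +
        Λ₂ ((degeneracyMap0 M (M * ℓ) ℓ 2).dualMap z))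
    (hU0 : ∀ z ∈ periodHomology (M * ℓ), Φ ((heckeT (Gamma0 (M * ℓ)) 2 ℓ).dualMap z) = 0)
    (hℓk : (ℓ : k) ≠ 0) :
    ∀ x ∈ periodHomology M, Λ₂ x = -((ℓ : k)⁻¹ * Λ₁ ((heckeT (Gamma0 M) 2 ℓ).dualMap x)) := by
  have hℓ : ℓ.Prime := Fact.out
  haveI : NeZero ℓ := ⟨hℓ.ne_zero⟩
  intro x hx
  obtain ⟨z, hz, hα⟩ := exists_dualMap_degeneracyMap0_one_eq_of_dvd hℓM hx
  have hUz : (heckeT (Gamma0 (M * ℓ)) 2 ℓ).dualMap z ∈ periodHomology (M * ℓ) :=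
    dualMap_heckeT_mem_periodHomology (M * ℓ) hℓ hz
  have h := hU0 z hz
  rw [hΦ _ hUz, dualMap_degeneracyMap0_one_dualMap_heckeT_of_dvd hℓM,
    dualMap_degeneracyMap0_self_dualMap_heckeT, hα, apply_natCast_smul_of_additive Λ₂ h0₂ hadd₂ hx ℓ] at h
  -- `h : Λ₁ (U x) + ℓ * Λ₂ x = 0`
  have e2 : (ℓ : k) * Λ₂ x = -Λ₁ ((heckeT (Gamma0 M) 2 ℓ).dualMap x) := by linear_combination h
  calc Λ₂ x = (ℓ : k)⁻¹ * ((ℓ : k) * Λ₂ x) := by rw [← mul_assoc, inv_mul_cancel₀ hℓk, one_mul]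
    _ = -((ℓ : k)⁻¹ * Λ₁ ((heckeT (Gamma0 M) 2 ℓ).dualMap x)) := by rw [e2]; ring

end Shape

end Summit.BirchSwinnertonDyer.Rank1Residual.LevelLowering

end
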